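import Summits.RiemannHypothesis.RiemannHypothesis.Theorems.SuzukiFlowPairingArchSeries
import Literature.NumberTheory.LFunctions.SuzukiSingleOperatorKernelProofs

/-!
# The archimedean term of Weil's functional for positive-definite Hölder test functions (column DBR; RH-FREE)

RH-FREE throughout; nothing here bears on the truth of RH.  Second half (spectral side) of the
extension of Bombieri's series form of the archimedean integral
`Σₙ (4π φ(0)/(n+1) − 4π ∫₀^∞ (φ(x)+φ(−x)) e^{−(2n+½)x} dx) = 2·weilArchIntegral φ + 4πγ φ(0)`
from smooth test functions (tree: `hasSum_weilArchIntegral`, [Bo00] (2.5)–(2.7)) to continuous, compactly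
supported `φ` that are HÖLDER and POSITIVE-DEFINITE on the critical line (`φ̂(½+iy)` real `≥ 0`) — the
class of the autocorrelations `g ⋆ g̃` of the θ-flow window outputs in `Theorems.SuzukiThetaFlowDefs.FlowPairing`.

Along the double mollification `ψ_k = (φ ⋆ φ_k) ⋆ φ_k` (`Theorems.SuzukiFlowPairingArchSeries`):
`ψ̂_k(½+iy) = φ̂(½+iy)·φ̂_k(½+iy)²` with `φ̂_k(½+iy)` REAL (`φ_k` is even), so the spectral integrands are
NON-NEGATIVE multiples of `φ̂`; FATOU then gives, with no Fourier-decay estimate at all,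
(i) `φ̂(½+i·) ∈ L¹` (`integrable_re_weilMellin_half`) and (ii) integrability of the archimedean integrand
`φ̂(½+iy)·Re ψ(¼+iy/2)` (`integrable_weilArchIntegrand_of_posDef`; `Re ψ(¼+iy/2) ≥ Re ψ(¼)`,
`re_digamma_ofReal_le_re_digamma`), the finiteness coming from the `x`-side limit (Tannery, first half);
dominated convergence and uniqueness of limits give the main theorem
**`hasSum_weilArchIntegral_of_posDef`**.

References: [Bo00] E. Bombieri, Rend. Lincei (9) 11 (2000), §2 (2.5)–(2.8).
-/

noncomputable section

-- D-0017: `Summit.<S>.<S>.…` is the designed namespace of a single-problem summit.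
set_option linter.dupNamespace false

open Complex Filter Set MeasureTheory Topology
open scoped Real

namespace Summit.RiemannHypothesis.RiemannHypothesis.Theorems.SuzukiFlowPairing

open Literature.NumberTheory.LFunctions Literature.NumberTheory.LFunctions.WeilContinuous

/-! ## §1 Transforms on the critical line -/

/-- RH-FREE.  `((1/2 : ℝ) : ℂ) = 1/2`. -/
theorem ofReal_half : (((1 / 2 : ℝ)) : ℂ) = 1 / 2 := by push_cast; ring

/-- RH-FREE.  The mollifier is its own reflection `φ̃_k = φ_k` (real and even; evenness is the tree's
`PfPersistence.moll_neg`, inlined here to keep the import light). -/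
theorem weilReflect_moll (k : ℕ) : weilReflect (moll k) = moll k := by
  funext t
  have hneg : moll k (-t) = moll k t := by simp [moll, ContDiffBump.normed_neg]
  simp only [weilReflect, hneg]
  simp [moll]

/-- RH-FREE.  `φ̂_k(½+iy)` is REAL. -/
theorem im_weilMellin_moll_half (k : ℕ) (y : ℝ) : (weilMellin (moll k) (1 / 2 + y * I)).im = 0 := by
  have h := weilMellin_weilReflect_holds (moll k) (1 / 2 + y * I)
  rw [weilReflect_moll] at h
  have hs : 1 - (starRingEnd ℂ) (1 / 2 + (y : ℂ) * I) = 1 / 2 + y * I := by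
    apply Complex.ext
    · simp; norm_num
    · simp
  rw [hs] at h
  exact Complex.conj_eq_iff_im.1 h.symm

/-- RH-FREE.  `φ̂_k(½+iy)` as a real number: `= ((Re φ̂_k(½+iy) : ℝ) : ℂ)`, with `|Re| ≤ 1`. -/
theorem weilMellin_moll_half_eq (k : ℕ) (y : ℝ) :
    weilMellin (moll k) (1 / 2 + y * I) = (((weilMellin (moll k) (1 / 2 + y * I)).re : ℝ) : ℂ) :=
  Complex.ext (by rw [Complex.ofReal_re]) (by rw [Complex.ofReal_im, im_weilMellin_moll_half])

/-- RH-FREE.  `|Re φ̂_k(½+iy)| ≤ 1`. -/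
theorem abs_re_weilMellin_moll_half_le (k : ℕ) (y : ℝ) : |(weilMellin (moll k) (1 / 2 + y * I)).re| ≤ 1 :=
  (Complex.abs_re_le_norm _).trans (norm_weilMellin_moll_half_le k y)

/-- RH-FREE.  `Re φ̂_k(½+iy) → 1`. -/
theorem tendsto_re_weilMellin_moll_half (y : ℝ) :
    Tendsto (fun k ↦ (weilMellin (moll k) (1 / 2 + y * I)).re) atTop (𝓝 1) := by
  have h := (Complex.continuous_re.tendsto 1).comp (tendsto_weilMellin_moll (1 / 2 + y * I))
  rw [Complex.one_re] at h
  exact h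

variable {φ : ℝ → ℂ}

/-- RH-FREE.  The transform of the double mollification: `ψ̂_k(s) = φ̂(s) φ̂_k(s)²`. -/
theorem weilMellin_moll2 (hφc : Continuous φ) (hφs : HasCompactSupport φ) (k : ℕ) (s : ℂ) :
    weilMellin (weilConv (weilConv φ (moll k)) (moll k)) s = weilMellin φ s * weilMellin (moll k) s ^ 2 := by
  have h1 := isWeilTest_weilConv_moll hφc hφs k
  rw [weilMellin_weilConv_moll h1.1.continuous h1.2, weilMellin_weilConv_moll hφc hφs]
  ring

/-- RH-FREE.  For `φ̂(½+iy)` real: `ψ̂_k(½+iy) = ((Re φ̂(½+iy) · (Re φ̂_k(½+iy))² : ℝ) : ℂ)`. -/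
theorem weilMellin_moll2_half (hφc : Continuous φ) (hφs : HasCompactSupport φ)
    (hre : ∀ y : ℝ, (weilMellin φ (1 / 2 + y * I)).im = 0) (k : ℕ) (y : ℝ) :
    weilMellin (weilConv (weilConv φ (moll k)) (moll k)) (1 / 2 + y * I) =
      ((((weilMellin φ (1 / 2 + y * I)).re * (weilMellin (moll k) (1 / 2 + y * I)).re ^ 2 : ℝ)) : ℂ) := by
  have hφ : weilMellin φ (1 / 2 + y * I) = (((weilMellin φ (1 / 2 + y * I)).re : ℝ) : ℂ) :=
    Complex.ext (by rw [Complex.ofReal_re]) (by rw [Complex.ofReal_im, hre y])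
  conv_lhs => rw [weilMellin_moll2 hφc hφs, hφ, weilMellin_moll_half_eq]
  push_cast
  ring

/-- RH-FREE.  The archimedean weight `Re ψ(¼ + iy/2)` is continuous in `y`. -/
theorem continuous_re_digamma_quarter : Continuous fun t : ℝ ↦ (digamma (1 / 4 + t / 2 * I)).re := by
  refine Complex.continuous_re.comp ?_
  refine Literature.Analysis.SpecialFunctions.Complex.continuousOn_digamma.comp_continuous (by fun_prop) fun t ↦ ?_
  simp

/-- RH-FREE.  `Re ψ(¼ + iy/2) ≥ Re ψ(¼)` (termwise in Gauss' series; tree `re_digamma_ofReal_le_re_digamma`). -/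
theorem re_digamma_quarter_le (t : ℝ) : (digamma (((1 / 4 : ℝ)) : ℂ)).re ≤ (digamma (1 / 4 + t / 2 * I)).re := by
  have h := re_digamma_ofReal_le_re_digamma (w := 1 / 4 + t / 2 * I) (by simp)
  have hw : ((1 : ℂ) / 4 + t / 2 * I).re = 1 / 4 := by simp
  rwa [hw] at h

/-- RH-FREE.  The archimedean integrand of a test function is integrable (tree pattern;
`|k̂| ≲ (1+t²)^{−2}`, `|ψ(¼+it/2)| ≲ log(2+|t|)`). -/
theorem integrable_weilArchIntegrand {k : ℝ → ℂ} (hk : IsWeilTest k) :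
    Integrable fun t : ℝ ↦ weilMellin k (1 / 2 + t * I) * ((digamma (1 / 4 + t / 2 * I)).re : ℂ) := by
  obtain ⟨C, hC⟩ := Literature.Analysis.SpecialFunctions.Complex.exists_norm_digamma_vertical_le
    (a := 1 / 4) (by norm_num)
  have hw : ∀ t : ℝ, (1 / 4 : ℂ) + (t : ℂ) / 2 * I = ((1 / 4 : ℝ) : ℂ) + ((t / 2 : ℝ) : ℂ) * I := by
    intro t; push_cast; ring
  have hFc : Continuous fun t : ℝ ↦ (((digamma (1 / 4 + t / 2 * I)).re : ℝ) : ℂ) :=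
    continuous_ofReal.comp continuous_re_digamma_quarter
  have hFb : ∀ t : ℝ, ‖(((digamma (1 / 4 + t / 2 * I)).re : ℝ) : ℂ)‖ ≤ C + Real.log (1 + |t|) := by
    intro t
    have h1 : ‖(((digamma (1 / 4 + t / 2 * I)).re : ℝ) : ℂ)‖ ≤ ‖digamma (1 / 4 + t / 2 * I)‖ := by
      rw [Complex.norm_real, Real.norm_eq_abs]; exact Complex.abs_re_le_norm _
    have h2 := hC (t / 2)
    rw [← hw t] at h2
    have h3 : Real.log (1 + |t / 2|) ≤ Real.log (1 + |t|) := by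
      refine Real.log_le_log (by positivity) ?_
      rw [abs_div, abs_two]; linarith [abs_nonneg t]
    linarith
  have hI := integrable_mul_weilMellin_vertical_of_norm_le_log hk (1 / 2) hFc hFb
  refine hI.congr (Eventually.of_forall fun t ↦ ?_)
  dsimp only
  rw [mul_comm]
  push_cast
  ring_nf

/-! ## §2 Fatou: integrability on the critical line from positivity -/

/-- RH-FREE.  **Abstract Fatou step**: if `0 ≤ F`, `0 ≤ W`, both continuous, and along a sequence of
multipliers `m_k → 1` with `|m_k| ≤ 1` the integrals `∫ F m_k² W` stay equal to a convergent real sequence,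
then `F·W` is integrable. -/
theorem integrable_of_fatou_mul {F W : ℝ → ℝ} {m : ℕ → ℝ → ℝ} (hF : Continuous F) (hW : Continuous W)
    (hF0 : ∀ y, 0 ≤ F y) (hW0 : ∀ y, 0 ≤ W y) (hm : ∀ k, Continuous (m k))
    (hm1 : ∀ y, Tendsto (fun k ↦ m k y) atTop (𝓝 1))
    (hint : ∀ k, Integrable fun y ↦ F y * m k y ^ 2 * W y) {a : ℕ → ℝ} {A : ℝ}
    (ha : ∀ k, ∫ y, F y * m k y ^ 2 * W y = a k) (hA : Tendsto a atTop (𝓝 A)) :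
    Integrable fun y ↦ F y * W y := by
  have hmeas : AEStronglyMeasurable (fun y ↦ F y * W y) volume := (hF.mul hW).aestronglyMeasurable
  have hnn : 0 ≤ᵐ[volume] fun y ↦ F y * W y := Eventually.of_forall fun y ↦ mul_nonneg (hF0 y) (hW0 y)
  refine ⟨hmeas, (hasFiniteIntegral_iff_ofReal hnn).2 ?_⟩
  -- Fatou along the sequence `g_k = F m_k² W`
  have hgk_meas : ∀ k, AEMeasurable (fun y ↦ ENNReal.ofReal (F y * m k y ^ 2 * W y)) volume := fun k ↦
    ((hF.mul ((hm k).pow 2)).mul hW).measurable.ennreal_ofReal.aemeasurable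
  have hlim : ∀ y, Tendsto (fun k ↦ ENNReal.ofReal (F y * m k y ^ 2 * W y)) atTop
      (𝓝 (ENNReal.ofReal (F y * W y))) := by
    intro y
    refine ENNReal.tendsto_ofReal ?_
    have h := ((hm1 y).pow 2).const_mul (F y)
    simpa using h.mul_const (W y)
  have hle := lintegral_liminf_le' (u := atTop) hgk_meas
  have hlhs : (fun y ↦ liminf (fun k ↦ ENNReal.ofReal (F y * m k y ^ 2 * W y)) atTop) =
      fun y ↦ ENNReal.ofReal (F y * W y) := funext fun y ↦ (hlim y).liminf_eq
  rw [hlhs] at hle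
  have hrhs : ∀ k, ∫⁻ y, ENNReal.ofReal (F y * m k y ^ 2 * W y) = ENNReal.ofReal (a k) := by
    intro k
    rw [← ha k, ofReal_integral_eq_lintegral_ofReal (hint k)
      (Eventually.of_forall fun y ↦ mul_nonneg (mul_nonneg (hF0 y) (sq_nonneg _)) (hW0 y))]
  simp_rw [hrhs] at hle
  have hla : liminf (fun k ↦ ENNReal.ofReal (a k)) atTop = ENNReal.ofReal A :=
    ((ENNReal.tendsto_ofReal hA)).liminf_eq
  rw [hla] at hle
  exact lt_of_le_of_lt hle ENNReal.ofReal_lt_top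

/-- RH-FREE.  **`φ̂(½+i·) ∈ L¹` for positive-definite `φ`** (continuous, compactly supported, Hölder):
Fatou against the constant weight, `∫ φ̂ φ̂_k² = 2π ψ_k(0) → 2π φ(0)`. -/
theorem integrable_re_weilMellin_half (hφc : Continuous φ) (hφs : HasCompactSupport φ)
    (hpos : ∀ y : ℝ, (weilMellin φ (1 / 2 + y * I)).im = 0 ∧ 0 ≤ (weilMellin φ (1 / 2 + y * I)).re)
    {C α : ℝ} (hC : 0 ≤ C) (hα : 0 < α) (hH : ∀ a y : ℝ, |y| ≤ 1 → ‖φ (a + y) - φ a‖ ≤ C * |y| ^ α) :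
    Integrable fun y : ℝ ↦ (weilMellin φ (1 / 2 + y * I)).re := by
  have hFc : Continuous fun y : ℝ ↦ (weilMellin φ (1 / 2 + y * I)).re :=
    Complex.continuous_re.comp ((continuous_weilMellin hφc hφs).comp (by fun_prop))
  have hmk : ∀ k, Continuous fun y : ℝ ↦ (weilMellin (moll k) (1 / 2 + y * I)).re := fun k ↦
    Complex.continuous_re.comp ((continuous_weilMellin (continuous_moll k) (hasCompactSupport_moll k)).comp
      (by fun_prop))
  -- the integrals `∫ φ̂ φ̂_k² = Re (2π ψ_k(0))`
  have hI : ∀ k, Integrable (fun y : ℝ ↦ (weilMellin φ (1 / 2 + y * I)).re *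
      (weilMellin (moll k) (1 / 2 + y * I)).re ^ 2 * 1) ∧
      ∫ y : ℝ, (weilMellin φ (1 / 2 + y * I)).re * (weilMellin (moll k) (1 / 2 + y * I)).re ^ 2 * 1 =
        (2 * π * weilConv (weilConv φ (moll k)) (moll k) 0).re := by
    intro k
    have hψ := isWeilTest_moll2 hφc hφs k
    have hint := integrable_weilMellin_vertical hψ (1 / 2)
    have hval := integral_weilMellin_vertical hψ (1 / 2)
    rw [ofReal_half] at hint hval
    have hpt : ∀ y : ℝ, ((weilMellin (weilConv (weilConv φ (moll k)) (moll k)) (1 / 2 + y * I)).re) =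
        (weilMellin φ (1 / 2 + y * I)).re * (weilMellin (moll k) (1 / 2 + y * I)).re ^ 2 * 1 := by
      intro y; rw [weilMellin_moll2_half hφc hφs (fun y ↦ (hpos y).1), Complex.ofReal_re, mul_one]
    have hre_int : ∫ y : ℝ, (weilMellin (weilConv (weilConv φ (moll k)) (moll k)) (1 / 2 + y * I)).re =
        (∫ y : ℝ, weilMellin (weilConv (weilConv φ (moll k)) (moll k)) (1 / 2 + y * I)).re := by
      have h := integral_re hint
      simpa only [RCLike.re_to_complex] using h
    refine ⟨(hint.re.congr (Eventually.of_forall fun y ↦ ?_)), ?_⟩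
    · simpa using hpt y
    · rw [← hval, ← hre_int]
      exact integral_congr_ae (Eventually.of_forall fun y ↦ (hpt y).symm)
  have hlim : Tendsto (fun k ↦ (2 * π * weilConv (weilConv φ (moll k)) (moll k) 0).re) atTop
      (𝓝 ((2 * π * φ 0).re)) :=
    (Complex.continuous_re.tendsto _).comp ((tendsto_moll2 hφc hφs hC hα hH 0).const_mul _)
  have h := integrable_of_fatou_mul (W := fun _ ↦ (1 : ℝ)) hFc continuous_const (fun y ↦ (hpos y).2)
    (fun _ ↦ zero_le_one) hmk tendsto_re_weilMellin_moll_half (fun k ↦ (hI k).1) (fun k ↦ (hI k).2) hlim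
  simpa using h

/-- RH-FREE.  **Integrability of the archimedean integrand for positive-definite Hölder `φ`**:
`y ↦ φ̂(½+iy)·Re ψ(¼+iy/2)` is integrable (Fatou against the weight `Re ψ(¼+iy/2) − Re ψ(¼) ≥ 0`, the
integrals along `ψ_k` being `Re weilArchIntegral ψ_k − 2π Re ψ(¼) Re ψ_k(0)`, convergent by the `x`-side). -/
theorem integrable_weilArchIntegrand_of_posDef (hφc : Continuous φ) (hφs : HasCompactSupport φ)
    (hpos : ∀ y : ℝ, (weilMellin φ (1 / 2 + y * I)).im = 0 ∧ 0 ≤ (weilMellin φ (1 / 2 + y * I)).re)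
    {C α : ℝ} (hC : 0 ≤ C) (hα : 0 < α) (hH : ∀ a y : ℝ, |y| ≤ 1 → ‖φ (a + y) - φ a‖ ≤ C * |y| ^ α) :
    Integrable fun t : ℝ ↦ weilMellin φ (1 / 2 + t * I) * ((digamma (1 / 4 + t / 2 * I)).re : ℂ) := by
  set c₀ : ℝ := (digamma (((1 / 4 : ℝ)) : ℂ)).re with hc₀
  set F : ℝ → ℝ := fun y ↦ (weilMellin φ (1 / 2 + y * I)).re with hFdef
  set D : ℝ → ℝ := fun t ↦ (digamma (1 / 4 + t / 2 * I)).re with hDdef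
  have hFc : Continuous F := Complex.continuous_re.comp ((continuous_weilMellin hφc hφs).comp (by fun_prop))
  have hDc : Continuous D := continuous_re_digamma_quarter
  have hmk : ∀ k, Continuous fun y : ℝ ↦ (weilMellin (moll k) (1 / 2 + y * I)).re := fun k ↦
    Complex.continuous_re.comp ((continuous_weilMellin (continuous_moll k) (hasCompactSupport_moll k)).comp
      (by fun_prop))
  -- x-side limit of the archimedean integrals of `ψ_k`
  obtain ⟨-, hT⟩ := tendsto_archSeries_moll2 hφc hφs hC hα hH
  set S := ∑' n : ℕ, (4 * π * φ 0 / ((n : ℂ) + 1) -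
    4 * π * ∫ x in Ioi (0 : ℝ), (φ x + φ (-x)) * cexp ((-(2 * (n : ℂ)) - 1 / 2) * x)) with hS
  have hψ0 := tendsto_moll2 hφc hφs hC hα hH 0
  have hAI : Tendsto (fun k ↦ weilArchIntegral (weilConv (weilConv φ (moll k)) (moll k))) atTop
      (𝓝 ((S - 4 * π * Real.eulerMascheroniConstant * φ 0) / 2)) := by
    have h := (hT.sub (hψ0.const_mul ((4 : ℂ) * π * Real.eulerMascheroniConstant))).div_const 2
    refine h.congr fun k ↦ ?_
    ring
  -- the integrals `∫ F m_k² (D − c₀) = Re A_k − c₀ · Re(2π ψ_k(0))`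
  have hI : ∀ k, Integrable (fun y : ℝ ↦ F y * (weilMellin (moll k) (1 / 2 + y * I)).re ^ 2 * (D y - c₀)) ∧
      ∫ y, F y * (weilMellin (moll k) (1 / 2 + y * I)).re ^ 2 * (D y - c₀) =
        (weilArchIntegral (weilConv (weilConv φ (moll k)) (moll k))).re -
          c₀ * (2 * π * weilConv (weilConv φ (moll k)) (moll k) 0).re := by
    intro k
    have hψ := isWeilTest_moll2 hφc hφs k
    have hint1 := integrable_weilArchIntegrand hψ
    have hint2 := integrable_weilMellin_vertical hψ (1 / 2)
    have hval2 := integral_weilMellin_vertical hψ (1 / 2)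
    rw [ofReal_half] at hint2 hval2
    have hptD : ∀ y : ℝ, (weilMellin (weilConv (weilConv φ (moll k)) (moll k)) (1 / 2 + y * I) *
        ((digamma (1 / 4 + y / 2 * I)).re : ℂ)).re = F y * (weilMellin (moll k) (1 / 2 + y * I)).re ^ 2 * D y := by
      intro y
      rw [weilMellin_moll2_half hφc hφs (fun y ↦ (hpos y).1), ← Complex.ofReal_mul, Complex.ofReal_re]
    have hpt1 : ∀ y : ℝ, (weilMellin (weilConv (weilConv φ (moll k)) (moll k)) (1 / 2 + y * I)).re =
        F y * (weilMellin (moll k) (1 / 2 + y * I)).re ^ 2 := by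
      intro y; rw [weilMellin_moll2_half hφc hφs (fun y ↦ (hpos y).1), Complex.ofReal_re]
    have hA : Integrable (fun y : ℝ ↦ F y * (weilMellin (moll k) (1 / 2 + y * I)).re ^ 2 * D y) :=
      hint1.re.congr (Eventually.of_forall fun y ↦ by simpa using hptD y)
    have hB : Integrable (fun y : ℝ ↦ F y * (weilMellin (moll k) (1 / 2 + y * I)).re ^ 2) :=
      hint2.re.congr (Eventually.of_forall fun y ↦ by simpa using hpt1 y)
    have hsplit : (fun y : ℝ ↦ F y * (weilMellin (moll k) (1 / 2 + y * I)).re ^ 2 * (D y - c₀)) =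
        fun y ↦ F y * (weilMellin (moll k) (1 / 2 + y * I)).re ^ 2 * D y -
          c₀ * (F y * (weilMellin (moll k) (1 / 2 + y * I)).re ^ 2) := by
      funext y; ring
    have hre1 : ∫ y : ℝ, (weilMellin (weilConv (weilConv φ (moll k)) (moll k)) (1 / 2 + y * I) *
        ((digamma (1 / 4 + y / 2 * I)).re : ℂ)).re =
        (weilArchIntegral (weilConv (weilConv φ (moll k)) (moll k))).re := by
      have h := integral_re hint1
      simp only [RCLike.re_to_complex] at h
      rw [h]
      rfl
    have hre2 : ∫ y : ℝ, (weilMellin (weilConv (weilConv φ (moll k)) (moll k)) (1 / 2 + y * I)).re =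
        (∫ y : ℝ, weilMellin (weilConv (weilConv φ (moll k)) (moll k)) (1 / 2 + y * I)).re := by
      have h := integral_re hint2
      simpa only [RCLike.re_to_complex] using h
    rw [hsplit]
    refine ⟨hA.sub (hB.const_mul c₀), ?_⟩
    rw [integral_sub hA (hB.const_mul c₀), integral_const_mul, ← hre1, ← hval2, ← hre2]
    congr 1
    · exact integral_congr_ae (Eventually.of_forall fun y ↦ (hptD y).symm)
    · congr 1
      exact integral_congr_ae (Eventually.of_forall fun y ↦ (hpt1 y).symm)
  have hlim : Tendsto (fun k ↦ (weilArchIntegral (weilConv (weilConv φ (moll k)) (moll k))).re -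
      c₀ * (2 * π * weilConv (weilConv φ (moll k)) (moll k) 0).re) atTop
      (𝓝 (((S - 4 * π * Real.eulerMascheroniConstant * φ 0) / 2).re - c₀ * (2 * π * φ 0).re)) :=
    ((Complex.continuous_re.tendsto _).comp hAI).sub
      (((Complex.continuous_re.tendsto _).comp (hψ0.const_mul _)).const_mul c₀)
  have hFD : Integrable fun y ↦ F y * (D y - c₀) :=
    integrable_of_fatou_mul (W := fun y ↦ D y - c₀) hFc (hDc.sub continuous_const) (fun y ↦ (hpos y).2)
      (fun y ↦ sub_nonneg.2 (re_digamma_quarter_le y)) hmk tendsto_re_weilMellin_moll_half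
      (fun k ↦ (hI k).1) (fun k ↦ (hI k).2) hlim
  have hF := integrable_re_weilMellin_half hφc hφs hpos hC hα hH
  have hFD' : Integrable fun y ↦ F y * D y := by
    have h := hFD.add (hF.const_mul c₀)
    refine h.congr (Eventually.of_forall fun y ↦ ?_)
    simp only [hFdef, Pi.add_apply]
    ring
  refine (hFD'.ofReal (𝕜 := ℂ)).congr (Eventually.of_forall fun y ↦ ?_)
  have hφ : weilMellin φ (1 / 2 + y * I) = ((F y : ℝ) : ℂ) :=
    Complex.ext (by rw [Complex.ofReal_re]) (by rw [Complex.ofReal_im]; exact (hpos y).1)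
  show ((F y * D y : ℝ) : ℂ) = weilMellin φ (1 / 2 + y * I) * ((digamma (1 / 4 + y / 2 * I)).re : ℂ)
  rw [hφ, Complex.ofReal_mul]

/-! ## §3 Dominated convergence and the main theorem -/

/-- RH-FREE.  `weilArchIntegral ψ_k → weilArchIntegral φ` (dominated convergence, `φ̂_k² ≤ 1`). -/
theorem tendsto_weilArchIntegral_moll2 (hφc : Continuous φ) (hφs : HasCompactSupport φ)
    (hpos : ∀ y : ℝ, (weilMellin φ (1 / 2 + y * I)).im = 0 ∧ 0 ≤ (weilMellin φ (1 / 2 + y * I)).re)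
    {C α : ℝ} (hC : 0 ≤ C) (hα : 0 < α) (hH : ∀ a y : ℝ, |y| ≤ 1 → ‖φ (a + y) - φ a‖ ≤ C * |y| ^ α) :
    Tendsto (fun k ↦ weilArchIntegral (weilConv (weilConv φ (moll k)) (moll k))) atTop
      (𝓝 (weilArchIntegral φ)) := by
  have hA := integrable_weilArchIntegrand_of_posDef hφc hφs hpos hC hα hH
  unfold weilArchIntegral
  simp_rw [weilMellin_moll2 hφc hφs]
  refine tendsto_integral_of_dominated_convergence
    (fun t ↦ ‖weilMellin φ (1 / 2 + t * I) * ((digamma (1 / 4 + t / 2 * I)).re : ℂ)‖) ?_ hA.norm ?_ ?_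
  · intro k
    have hc : Continuous fun t : ℝ ↦ weilMellin (moll k) (1 / 2 + t * I) ^ 2 :=
      ((continuous_weilMellin (continuous_moll k) (hasCompactSupport_moll k)).comp (by fun_prop)).pow 2
    have heq : (fun t : ℝ ↦ weilMellin φ (1 / 2 + t * I) * weilMellin (moll k) (1 / 2 + t * I) ^ 2 *
        ((digamma (1 / 4 + t / 2 * I)).re : ℂ)) = fun t : ℝ ↦
        (weilMellin φ (1 / 2 + t * I) * ((digamma (1 / 4 + t / 2 * I)).re : ℂ)) *
          weilMellin (moll k) (1 / 2 + t * I) ^ 2 := by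
      funext t; ring
    rw [heq]
    exact hA.aestronglyMeasurable.mul hc.aestronglyMeasurable
  · intro k
    refine Eventually.of_forall fun t ↦ ?_
    have h1 : ‖weilMellin (moll k) (1 / 2 + t * I) ^ 2‖ ≤ 1 := by
      rw [norm_pow]
      exact pow_le_one₀ (norm_nonneg _) (norm_weilMellin_moll_half_le k t)
    calc ‖weilMellin φ (1 / 2 + t * I) * weilMellin (moll k) (1 / 2 + t * I) ^ 2 *
          ((digamma (1 / 4 + t / 2 * I)).re : ℂ)‖
        = ‖weilMellin φ (1 / 2 + t * I) * ((digamma (1 / 4 + t / 2 * I)).re : ℂ)‖ *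
            ‖weilMellin (moll k) (1 / 2 + t * I) ^ 2‖ := by
          rw [norm_mul, norm_mul, norm_mul]; ring
      _ ≤ ‖weilMellin φ (1 / 2 + t * I) * ((digamma (1 / 4 + t / 2 * I)).re : ℂ)‖ * 1 := by gcongr
      _ = _ := mul_one _
  · refine Eventually.of_forall fun t ↦ ?_
    have h := (((tendsto_weilMellin_moll (1 / 2 + t * I)).pow 2).const_mul
      (weilMellin φ (1 / 2 + t * I))).mul_const ((digamma (1 / 4 + t / 2 * I)).re : ℂ)
    simpa using h

/-- **RH-FREE · THE ARCHIMEDEAN SERIES FOR POSITIVE-DEFINITE HÖLDER TEST FUNCTIONS**: let `φ : ℝ → ℂ` be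
continuous with compact support, with `φ̂(½+iy)` real and `≥ 0` for all real `y`, and Hölder
(`‖φ(a+y) − φ(a)‖ ≤ C|y|^α` for `|y| ≤ 1`, some `C ≥ 0`, `α > 0`).  Then the archimedean integrand
`φ̂(½+iy)·Re ψ(¼+iy/2)` is integrable and Bombieri's series holds:
`Σₙ (4π φ(0)/(n+1) − 4π ∫₀^∞ (φ(x)+φ(−x)) e^{−(2n+½)x} dx) = 2·weilArchIntegral φ + 4πγ φ(0)`
(extension of the tree's smooth `hasSum_weilArchIntegral`).  Nothing here bears on RH. -/
theorem hasSum_weilArchIntegral_of_posDef (hφc : Continuous φ) (hφs : HasCompactSupport φ)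
    (hpos : ∀ y : ℝ, (weilMellin φ (1 / 2 + y * I)).im = 0 ∧ 0 ≤ (weilMellin φ (1 / 2 + y * I)).re)
    {C α : ℝ} (hC : 0 ≤ C) (hα : 0 < α) (hH : ∀ a y : ℝ, |y| ≤ 1 → ‖φ (a + y) - φ a‖ ≤ C * |y| ^ α) :
    Integrable (fun t : ℝ ↦ weilMellin φ (1 / 2 + t * I) * ((digamma (1 / 4 + t / 2 * I)).re : ℂ)) ∧
    HasSum (fun n : ℕ ↦ 4 * π * φ 0 / ((n : ℂ) + 1) -
        4 * π * ∫ x in Ioi (0 : ℝ), (φ x + φ (-x)) * cexp ((-(2 * (n : ℂ)) - 1 / 2) * x))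
      (2 * weilArchIntegral φ + 4 * π * Real.eulerMascheroniConstant * φ 0) := by
  obtain ⟨hsum, hT⟩ := tendsto_archSeries_moll2 hφc hφs hC hα hH
  refine ⟨integrable_weilArchIntegrand_of_posDef hφc hφs hpos hC hα hH, ?_⟩
  have h2 : Tendsto (fun k ↦ 2 * weilArchIntegral (weilConv (weilConv φ (moll k)) (moll k)) +
      4 * π * Real.eulerMascheroniConstant * weilConv (weilConv φ (moll k)) (moll k) 0) atTop
      (𝓝 (2 * weilArchIntegral φ + 4 * π * Real.eulerMascheroniConstant * φ 0)) :=
    ((tendsto_weilArchIntegral_moll2 hφc hφs hpos hC hα hH).const_mul 2).add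
      ((tendsto_moll2 hφc hφs hC hα hH 0).const_mul _)
  rw [← tendsto_nhds_unique hT h2]
  exact hsum.hasSum

end Summit.RiemannHypothesis.RiemannHypothesis.Theorems.SuzukiFlowPairing

end
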